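import Mathlib.AlgebraicGeometry.EllipticCurve.DivisionPolynomial.Basic
import Literature.NumberTheory.EllipticCurves.DivisionPolynomialTorsion
import HarnessLib

/-!
# BirchSwinnertonDyer — rank-2 `Ш[p^∞]` cell, STRUCTURE track: `Φ₃ − Ψ₂Sq³` is divisible by `Ψ₃`

HONEST FRAMING (cell `b2b-bsdr2sha`, run/shared/lean/b2b/bsd-rank2-sha/, STRUCTURE.md /
structure/THEORY-NOTE-C5.md supplement 4, «TYPING TARGET #1 for a Lean seat»): an ELEMENTARY
polynomial identity in `ℤ[a₁,…,a₆][X]` for Mathlib's division polynomials of a Weierstrass curve and its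
immediate consequence at points of order `3`; it is the case `n = 3` of the cell's «Theorem A»
(`φₙ(x(T)) = κ_Tⁿ` is an `n`-th power for `T` of odd order `n`), the proved SPLIT HALF of the cell's
conjecture C7 about the Fermat quotient of `φ_p(x)` at anomalous primes. Nothing here concerns BSD,
`Ш`, or any census number; no definition, no named fact, no hypothesis beyond Mathlib's.

CONTENT.
* `preΨ₄_add_Ψ₂Sq_sq` : `preΨ₄ + Ψ₂Sq² = (6X² + b₂X + b₄)·Ψ₃` (a `ring` identity once the `bᵢ` are
  unfolded to the `aᵢ`; it uses the definition of `b₈` in terms of the `aᵢ`).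
* `Φ_three_sub_Ψ₂Sq_pow_three` : `Φ₃ − Ψ₂Sq³ = Ψ₃·(X·Ψ₃ − (6X² + b₂X + b₄)·Ψ₂Sq)`, from Mathlib's
  `WeierstrassCurve.Φ_three : Φ₃ = X·Ψ₃² − preΨ₄·Ψ₂Sq` and the first identity.
* `eval_Φ_three_eq_pow_three_of_eval_Ψ₃` : at a root `x` of `Ψ₃`, `Φ₃(x) = Ψ₂Sq(x)³`.
* `eval_Φ_three_eq_ψ₂_pow_six_of_three_smul_eq_zero` : over a field, for an affine point `P = (x, y)`
  with `3 • P = 0` that is not `2`-torsion, `Φ₃(x) = ψ₂(x, y)⁶` — the numerator of `x(3P)` evaluated at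
  `x(P)` is a sixth power (`ψ₂ = 2y + a₁x + a₃`), via the tree's
  `WeierstrassCurve.three_smul_some_eq_zero_iff` and `WeierstrassCurve.evalEval_ψ_sq`
  (Literature/NumberTheory/EllipticCurves/DivisionPolynomialTorsion.lean, Silverman AEC Exercise 3.7).

References: J. H. Silverman, *The Arithmetic of Elliptic Curves* (2009), Exercise 3.7
[SilvermanAEC2009]; Mathlib `Mathlib/AlgebraicGeometry/EllipticCurve/DivisionPolynomial/Basic.lean`.
-/

set_option autoImplicit false

-- single-conjunct summit: `Summit.BirchSwinnertonDyer.BirchSwinnertonDyer.…` repeats the name by design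
set_option linter.dupNamespace false

open Polynomial

namespace Summit.BirchSwinnertonDyer.BirchSwinnertonDyer.Rank2Sha.Structure

section Ring

variable {R : Type*} [CommRing R] (W : WeierstrassCurve R)

/-- `preΨ₄ + Ψ₂Sq² = (6X² + b₂X + b₄)·Ψ₃` in `R[X]` for every Weierstrass curve over a commutative
ring `R` (an identity in `ℤ[a₁,…,a₆][X]`; it uses `b₈ = a₁²a₆ + 4a₂a₆ − a₁a₃a₄ + a₂a₃² − a₄²`). -/
theorem preΨ₄_add_Ψ₂Sq_sq :
    W.preΨ₄ + W.Ψ₂Sq ^ 2 = (C 6 * X ^ 2 + C W.b₂ * X + C W.b₄) * W.Ψ₃ := by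
  simp only [WeierstrassCurve.preΨ₄, WeierstrassCurve.Ψ₂Sq, WeierstrassCurve.Ψ₃, WeierstrassCurve.b₂,
    WeierstrassCurve.b₄, WeierstrassCurve.b₆, WeierstrassCurve.b₈, map_ofNat, C_add, C_sub, C_mul,
    C_pow]
  ring

/-- **`Φ₃ − Ψ₂Sq³` is divisible by `Ψ₃`**: `Φ₃ − Ψ₂Sq³ = Ψ₃·(X·Ψ₃ − (6X² + b₂X + b₄)·Ψ₂Sq)` in `R[X]`
(Mathlib's `Φ_three : Φ₃ = X·Ψ₃² − preΨ₄·Ψ₂Sq` combined with `preΨ₄_add_Ψ₂Sq_sq`). Consequently the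
numerator `Φ₃(x)` of `x(3P)` is congruent to the cube `Ψ₂Sq(x)³` modulo the `3`-division polynomial. -/
theorem Φ_three_sub_Ψ₂Sq_pow_three :
    W.Φ 3 - W.Ψ₂Sq ^ 3 = W.Ψ₃ * (X * W.Ψ₃ - (C 6 * X ^ 2 + C W.b₂ * X + C W.b₄) * W.Ψ₂Sq) := by
  rw [WeierstrassCurve.Φ_three]
  linear_combination (-W.Ψ₂Sq) * preΨ₄_add_Ψ₂Sq_sq W

/-- At a root `x` of the `3`-division polynomial `Ψ₃`, the numerator of `x(3P)` is a cube:
`Φ₃(x) = Ψ₂Sq(x)³`. -/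
theorem eval_Φ_three_eq_pow_three_of_eval_Ψ₃ {x : R} (hx : (W.Ψ₃).eval x = 0) :
    (W.Φ 3).eval x = ((W.Ψ₂Sq).eval x) ^ 3 := by
  have h := congrArg (Polynomial.eval x) (Φ_three_sub_Ψ₂Sq_pow_three W)
  simp only [eval_sub, eval_pow, eval_mul, hx, zero_mul] at h
  linear_combination h

end Ring

section Field

variable {K : Type*} [Field K] [DecidableEq K] (V : WeierstrassCurve K)

/-- **Theorem A of the cell's STRUCTURE note for `n = 3`.** Over a field `K`, let `P = (x, y)` be a
nonsingular affine point of `V` (a generic `[DecidableEq K]` as in Mathlib's group law) which is not `2`-torsion (`y ≠ −y − a₁x − a₃`) and satisfies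
`3 • P = 0`. Then `Φ₃(x) = ψ₂(x, y)⁶` with `ψ₂ = 2y + a₁x + a₃`: the numerator of `x(3P)` at `x(P)` is
the sixth power of `ψ₂(P)` (so a cube, `κ_P³` with `κ_P = ψ₂(P)²`). Proof: `3 • P = 0 ↔ Ψ₃(x) = 0`
(tree: `three_smul_some_eq_zero_iff`), `Φ₃(x) = Ψ₂Sq(x)³` at roots of `Ψ₃`, and
`ψ₂(x, y)² = Ψ₂Sq(x)` on the curve (tree: `evalEval_ψ_sq` at `n = 2`, Mathlib `ΨSq_two`). -/
theorem eval_Φ_three_eq_ψ₂_pow_six_of_three_smul_eq_zero {x y : K}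
    (h : V.toAffine.Nonsingular x y) (hy : y ≠ V.toAffine.negY x y)
    (h3 : (3 : ℤ) • (WeierstrassCurve.Affine.Point.some x y h : V.toAffine.Point) = 0) :
    (V.Φ 3).eval x = ((V.ψ 2).evalEval x y) ^ 6 := by
  have hΨ₃ : (V.Ψ₃).eval x = 0 := by
    have e := (V.three_smul_some_eq_zero_iff h hy).mp h3
    rwa [WeierstrassCurve.ψ_three, evalEval_C] at e
  have hsq : ((V.ψ 2).evalEval x y) ^ 2 = (V.Ψ₂Sq).eval x := by
    rw [V.evalEval_ψ_sq h.left 2, WeierstrassCurve.ΨSq_two]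
  rw [eval_Φ_three_eq_pow_three_of_eval_Ψ₃ V hΨ₃, ← hsq]
  ring

end Field

end Summit.BirchSwinnertonDyer.BirchSwinnertonDyer.Rank2Sha.Structure
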